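import Mathlib
import Literature.Analysis.FluidPDE.SawtoothCascade
import Summits.AnomalousDissipation.AnomalousDissipation.Theorems.SawtoothPulseCascadeK1LocalisedCascadeKHForcingPieces

/-!
# K2 lane (route-2 `SawtoothPulseCascade`, crux dir `K1LocalisedCascade`): the TRANSPORT COEFFICIENT of a slot in closed form, and its sinc-tail locality

Helper file of the K2 lane (ACL item stmt-AnomalousDissipation-19491; E6-b / (T) of the certified-core atom spec `K2AtomSpec.md`). The transverse
Fourier coefficient of a transported mode, `τ(a,θ; ξ → ξ′) = ∫_{−½}^{½} e^{2πiξy} e^{−2πiaθ·tri(y)} e^{−2πiξ′y} dy` (p4's `hTransport`/`vTransport` via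
`coeff`), splits over the three linear pieces of the triangle wave (trough `[−½,−¼]`: `tri = −½ − y`; centre `[−¼,¼]`: `tri = y`; crest `[¼,½]`:
`tri = ½ − y`) into three elementary integrals `e^{iφ_P}·(e^{iΛ_P y₂} − e^{iΛ_P y₁})/(iΛ_P)` with `Λ₊ = 2π(ξ − ξ′ + aθ)` (trough, crest) and
`Λ₋ = 2π(ξ − ξ′ − aθ)` (centre) (`transport_coeff_eq`); hence **`‖τ‖ ≤ 4/|Λ₊| + 2/|Λ₋|`** (`norm_transport_coeff_le`): the transported mode's spectrum is
concentrated within `O(1)` of `ξ′ = ξ ∓ aθ` with `1/distance` (sinc) tails — the locality behind the Orr bookkeeping. Also `‖τ‖ ≤ 1` trivially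
(`norm_transport_coeff_le_one`). No definitions; no statement about the crux. [cite: ElgindiLissMattingly2025, §1 (H_α, V_α)] [problem: turb]
-/

-- `Summit.<Summit>.<Problem>`: single-conjunct summit, the duplicate namespace segment is deliberate.
set_option linter.dupNamespace false

noncomputable section

namespace Summit.AnomalousDissipation.AnomalousDissipation.Theorems.SawtoothPulseCascade.K2PhaseBudget

open Set MeasureTheory intervalIntegral Literature.Analysis.FluidPDE.SawtoothCascade

/-- The triangle wave is continuous. [cite: ElgindiLissMattingly2025, §1 (H_α, V_α)] -/
theorem continuous_triWave' : Continuous triWave := by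
  have h : triWave = (fun t : ℝ => 1 / 4 - |t - 1 / 2|) ∘ Int.fract ∘ (fun ξ : ℝ => ξ + 1 / 4) := by
    funext ξ; simp [triWave, Function.comp]
  rw [h]
  have hI : Continuous ((fun t : ℝ => 1 / 4 - |t - 1 / 2|) ∘ Int.fract) :=
    ContinuousOn.comp_fract'' (Continuous.continuousOn (by fun_prop)) (by norm_num)
  exact hI.comp (continuous_id.add continuous_const)

/-- One linear piece: `∫_{y₁}^{y₂} e^{i(c₀ + Λy)} dy = e^{ic₀}(e^{iΛy₂} − e^{iΛy₁})/(iΛ)` (`Λ ≠ 0`). [folklore] -/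
theorem integral_cexp_affine {Λ : ℝ} (hΛ : Λ ≠ 0) (c₀ y₁ y₂ : ℝ) :
    ∫ y in y₁..y₂, Complex.exp (((c₀ + Λ * y : ℝ) : ℂ) * Complex.I) =
      Complex.exp ((c₀ : ℂ) * Complex.I) * ((Complex.exp (((Λ : ℂ) * Complex.I) * y₂) - Complex.exp (((Λ : ℂ) * Complex.I) * y₁)) / ((Λ : ℂ) * Complex.I)) := by
  have hc : ((Λ : ℂ) * Complex.I) ≠ 0 := mul_ne_zero (by exact_mod_cast hΛ) Complex.I_ne_zero
  have e : ∀ y : ℝ, Complex.exp (((c₀ + Λ * y : ℝ) : ℂ) * Complex.I) = Complex.exp ((c₀ : ℂ) * Complex.I) * Complex.exp (((Λ : ℂ) * Complex.I) * y) := by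
    intro y; rw [← Complex.exp_add]; congr 1; push_cast; ring
  simp_rw [e]
  rw [intervalIntegral.integral_const_mul, integral_exp_mul_complex hc]

/-- `‖(e^{iΛy₂} − e^{iΛy₁})/(iΛ)‖ ≤ 2/|Λ|`. [folklore] -/
theorem norm_twoExp_div_le (Λ y₁ y₂ : ℝ) :
    ‖(Complex.exp (((Λ : ℂ) * Complex.I) * y₂) - Complex.exp (((Λ : ℂ) * Complex.I) * y₁)) / ((Λ : ℂ) * Complex.I)‖ ≤ 2 / |Λ| := by
  rw [norm_div, norm_mul, Complex.norm_real, Complex.norm_I, mul_one, Real.norm_eq_abs]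
  apply div_le_div_of_nonneg_right _ (abs_nonneg _)
  have h1 : ‖Complex.exp (((Λ : ℂ) * Complex.I) * y₂)‖ = 1 := by
    rw [show ((Λ : ℂ) * Complex.I) * y₂ = ((Λ * y₂ : ℝ) : ℂ) * Complex.I by push_cast; ring]; exact Complex.norm_exp_ofReal_mul_I _
  have h2 : ‖Complex.exp (((Λ : ℂ) * Complex.I) * y₁)‖ = 1 := by
    rw [show ((Λ : ℂ) * Complex.I) * y₁ = ((Λ * y₁ : ℝ) : ℂ) * Complex.I by push_cast; ring]; exact Complex.norm_exp_ofReal_mul_I _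
  calc _ ≤ ‖Complex.exp (((Λ : ℂ) * Complex.I) * y₂)‖ + ‖Complex.exp (((Λ : ℂ) * Complex.I) * y₁)‖ := norm_sub_le _ _
    _ = 2 := by rw [h1, h2]; norm_num

/-- The transported-mode integrand on each linear piece of the triangle wave is `e^{i(c₀ + Λy)}`. [cite: ElgindiLissMattingly2025, §1 (H_α, V_α)] -/
theorem transport_integrand_trough (a θ ξ ξ' : ℝ) {y : ℝ} (hy : y ∈ Icc (-(1 / 2 : ℝ)) (-(1 / 4 : ℝ))) :
    Complex.exp (((2 * Real.pi * ξ * y : ℝ) : ℂ) * Complex.I) * Complex.exp (-((2 * Real.pi * a * θ * triWave y : ℝ) : ℂ) * Complex.I) *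
        Complex.exp (-((2 * Real.pi * ξ' * y : ℝ) : ℂ) * Complex.I) =
      Complex.exp (((Real.pi * a * θ + (2 * Real.pi * (ξ - ξ' + a * θ)) * y : ℝ) : ℂ) * Complex.I) := by
  have hT : triWave y = -(1 / 2) - y := triWave_eq_neg_half_sub (by linarith [hy.1, hy.2]) (by linarith [hy.1, hy.2])
  rw [hT, ← Complex.exp_add, ← Complex.exp_add]; congr 1; push_cast; ring

/-- Centre piece. [cite: ElgindiLissMattingly2025, §1 (H_α, V_α)] -/
theorem transport_integrand_centre (a θ ξ ξ' : ℝ) {y : ℝ} (hy : y ∈ Icc (-(1 / 4 : ℝ)) (1 / 4 : ℝ)) :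
    Complex.exp (((2 * Real.pi * ξ * y : ℝ) : ℂ) * Complex.I) * Complex.exp (-((2 * Real.pi * a * θ * triWave y : ℝ) : ℂ) * Complex.I) *
        Complex.exp (-((2 * Real.pi * ξ' * y : ℝ) : ℂ) * Complex.I) =
      Complex.exp (((0 + (2 * Real.pi * (ξ - ξ' - a * θ)) * y : ℝ) : ℂ) * Complex.I) := by
  have hT : triWave y = y := triWave_eq_self (by linarith [hy.1, hy.2]) (by linarith [hy.1, hy.2])
  rw [hT, ← Complex.exp_add, ← Complex.exp_add]; congr 1; push_cast; ring

/-- Crest piece. [cite: ElgindiLissMattingly2025, §1 (H_α, V_α)] -/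
theorem transport_integrand_crest (a θ ξ ξ' : ℝ) {y : ℝ} (hy : y ∈ Icc (1 / 4 : ℝ) (1 / 2 : ℝ)) :
    Complex.exp (((2 * Real.pi * ξ * y : ℝ) : ℂ) * Complex.I) * Complex.exp (-((2 * Real.pi * a * θ * triWave y : ℝ) : ℂ) * Complex.I) *
        Complex.exp (-((2 * Real.pi * ξ' * y : ℝ) : ℂ) * Complex.I) =
      Complex.exp (((-(Real.pi * a * θ) + (2 * Real.pi * (ξ - ξ' + a * θ)) * y : ℝ) : ℂ) * Complex.I) := by
  have hT : triWave y = 1 / 2 - y := triWave_eq_half_sub (by linarith [hy.1, hy.2]) (by linarith [hy.1, hy.2])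
  rw [hT, ← Complex.exp_add, ← Complex.exp_add]; congr 1; push_cast; ring

/-- **The transport coefficient in closed form** (`Λ₊ = 2π(ξ−ξ′+aθ) ≠ 0`, `Λ₋ = 2π(ξ−ξ′−aθ) ≠ 0`). [cite: ElgindiLissMattingly2025, §1 (H_α, V_α)] -/
theorem transport_coeff_eq (a θ ξ ξ' : ℝ) (hp : 2 * Real.pi * (ξ - ξ' + a * θ) ≠ 0) (hm : 2 * Real.pi * (ξ - ξ' - a * θ) ≠ 0) :
    ∫ y in (-(1 / 2 : ℝ))..(1 / 2 : ℝ), Complex.exp (((2 * Real.pi * ξ * y : ℝ) : ℂ) * Complex.I) *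
        Complex.exp (-((2 * Real.pi * a * θ * triWave y : ℝ) : ℂ) * Complex.I) * Complex.exp (-((2 * Real.pi * ξ' * y : ℝ) : ℂ) * Complex.I) =
      Complex.exp (((Real.pi * a * θ : ℝ) : ℂ) * Complex.I) *
          ((Complex.exp ((((2 * Real.pi * (ξ - ξ' + a * θ) : ℝ) : ℂ) * Complex.I) * (-(1 / 4 : ℝ) : ℝ)) -
              Complex.exp ((((2 * Real.pi * (ξ - ξ' + a * θ) : ℝ) : ℂ) * Complex.I) * (-(1 / 2 : ℝ) : ℝ))) /
            (((2 * Real.pi * (ξ - ξ' + a * θ) : ℝ) : ℂ) * Complex.I)) +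
        Complex.exp (((0 : ℝ) : ℂ) * Complex.I) *
          ((Complex.exp ((((2 * Real.pi * (ξ - ξ' - a * θ) : ℝ) : ℂ) * Complex.I) * ((1 / 4 : ℝ) : ℝ)) -
              Complex.exp ((((2 * Real.pi * (ξ - ξ' - a * θ) : ℝ) : ℂ) * Complex.I) * (-(1 / 4 : ℝ) : ℝ))) /
            (((2 * Real.pi * (ξ - ξ' - a * θ) : ℝ) : ℂ) * Complex.I)) +
        Complex.exp (((-(Real.pi * a * θ) : ℝ) : ℂ) * Complex.I) *
          ((Complex.exp ((((2 * Real.pi * (ξ - ξ' + a * θ) : ℝ) : ℂ) * Complex.I) * ((1 / 2 : ℝ) : ℝ)) -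
              Complex.exp ((((2 * Real.pi * (ξ - ξ' + a * θ) : ℝ) : ℂ) * Complex.I) * ((1 / 4 : ℝ) : ℝ))) /
            (((2 * Real.pi * (ξ - ξ' + a * θ) : ℝ) : ℂ) * Complex.I)) := by
  set F : ℝ → ℂ := fun y => Complex.exp (((2 * Real.pi * ξ * y : ℝ) : ℂ) * Complex.I) *
        Complex.exp (-((2 * Real.pi * a * θ * triWave y : ℝ) : ℂ) * Complex.I) * Complex.exp (-((2 * Real.pi * ξ' * y : ℝ) : ℂ) * Complex.I) with hF
  have hc : Continuous F := by rw [hF]; have := continuous_triWave'; fun_prop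
  have hi : ∀ u v : ℝ, IntervalIntegrable F volume u v := fun u v => hc.intervalIntegrable u v
  rw [← intervalIntegral.integral_add_adjacent_intervals (hi (-(1 / 2)) (-(1 / 4))) (hi (-(1 / 4)) (1 / 2)),
    ← intervalIntegral.integral_add_adjacent_intervals (hi (-(1 / 4)) (1 / 4)) (hi (1 / 4) (1 / 2))]
  have h1 : ∫ y in (-(1 / 2 : ℝ))..(-(1 / 4 : ℝ)), F y = ∫ y in (-(1 / 2 : ℝ))..(-(1 / 4 : ℝ)),
      Complex.exp (((Real.pi * a * θ + (2 * Real.pi * (ξ - ξ' + a * θ)) * y : ℝ) : ℂ) * Complex.I) :=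
    intervalIntegral.integral_congr fun y hy => by
      rw [uIcc_of_le (by norm_num)] at hy; exact transport_integrand_trough a θ ξ ξ' hy
  have h2 : ∫ y in (-(1 / 4 : ℝ))..(1 / 4 : ℝ), F y = ∫ y in (-(1 / 4 : ℝ))..(1 / 4 : ℝ),
      Complex.exp (((0 + (2 * Real.pi * (ξ - ξ' - a * θ)) * y : ℝ) : ℂ) * Complex.I) :=
    intervalIntegral.integral_congr fun y hy => by
      rw [uIcc_of_le (by norm_num)] at hy; exact transport_integrand_centre a θ ξ ξ' hy
  have h3 : ∫ y in (1 / 4 : ℝ)..(1 / 2 : ℝ), F y = ∫ y in (1 / 4 : ℝ)..(1 / 2 : ℝ),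
      Complex.exp (((-(Real.pi * a * θ) + (2 * Real.pi * (ξ - ξ' + a * θ)) * y : ℝ) : ℂ) * Complex.I) :=
    intervalIntegral.integral_congr fun y hy => by
      rw [uIcc_of_le (by norm_num)] at hy; exact transport_integrand_crest a θ ξ ξ' hy
  rw [h1, h2, h3, integral_cexp_affine hp, integral_cexp_affine hm, integral_cexp_affine hp]
  push_cast
  ring

/-- **Locality (sinc tails):** `‖τ(a,θ; ξ→ξ′)‖ ≤ 4/|Λ₊| + 2/|Λ₋|`. [cite: ElgindiLissMattingly2025, §1 (H_α, V_α)] -/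
theorem norm_transport_coeff_le (a θ ξ ξ' : ℝ) (hp : 2 * Real.pi * (ξ - ξ' + a * θ) ≠ 0) (hm : 2 * Real.pi * (ξ - ξ' - a * θ) ≠ 0) :
    ‖∫ y in (-(1 / 2 : ℝ))..(1 / 2 : ℝ), Complex.exp (((2 * Real.pi * ξ * y : ℝ) : ℂ) * Complex.I) *
        Complex.exp (-((2 * Real.pi * a * θ * triWave y : ℝ) : ℂ) * Complex.I) * Complex.exp (-((2 * Real.pi * ξ' * y : ℝ) : ℂ) * Complex.I)‖ ≤
      4 / |2 * Real.pi * (ξ - ξ' + a * θ)| + 2 / |2 * Real.pi * (ξ - ξ' - a * θ)| := by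
  rw [transport_coeff_eq a θ ξ ξ' hp hm]
  have b1 := norm_twoExp_div_le (2 * Real.pi * (ξ - ξ' + a * θ)) (-(1 / 2 : ℝ)) (-(1 / 4 : ℝ))
  have b2 := norm_twoExp_div_le (2 * Real.pi * (ξ - ξ' - a * θ)) (-(1 / 4 : ℝ)) (1 / 4 : ℝ)
  have b3 := norm_twoExp_div_le (2 * Real.pi * (ξ - ξ' + a * θ)) (1 / 4 : ℝ) (1 / 2 : ℝ)
  have u1 : ‖Complex.exp (((Real.pi * a * θ : ℝ) : ℂ) * Complex.I)‖ = 1 := Complex.norm_exp_ofReal_mul_I _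
  have u2 : ‖Complex.exp (((0 : ℝ) : ℂ) * Complex.I)‖ = 1 := Complex.norm_exp_ofReal_mul_I _
  have u3 : ‖Complex.exp (((-(Real.pi * a * θ) : ℝ) : ℂ) * Complex.I)‖ = 1 := Complex.norm_exp_ofReal_mul_I _
  refine (norm_add₃_le).trans ?_
  rw [norm_mul, norm_mul, norm_mul, u1, u2, u3, one_mul, one_mul, one_mul]
  have := add_le_add (add_le_add b1 b2) b3
  refine this.trans (le_of_eq ?_)
  ring

/-- The trivial bound `‖τ‖ ≤ 1` (unimodular integrand on a unit interval). [folklore] -/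
theorem norm_transport_coeff_le_one (a θ ξ ξ' : ℝ) :
    ‖∫ y in (-(1 / 2 : ℝ))..(1 / 2 : ℝ), Complex.exp (((2 * Real.pi * ξ * y : ℝ) : ℂ) * Complex.I) *
        Complex.exp (-((2 * Real.pi * a * θ * triWave y : ℝ) : ℂ) * Complex.I) * Complex.exp (-((2 * Real.pi * ξ' * y : ℝ) : ℂ) * Complex.I)‖ ≤ 1 := by
  have h := intervalIntegral.norm_integral_le_of_norm_le_const (a := -(1 / 2 : ℝ)) (b := (1 / 2 : ℝ)) (C := 1)
    (f := fun y => Complex.exp (((2 * Real.pi * ξ * y : ℝ) : ℂ) * Complex.I) *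
        Complex.exp (-((2 * Real.pi * a * θ * triWave y : ℝ) : ℂ) * Complex.I) * Complex.exp (-((2 * Real.pi * ξ' * y : ℝ) : ℂ) * Complex.I))
    (fun y _ => by
      rw [norm_mul, norm_mul, Complex.norm_exp_ofReal_mul_I,
        show -((2 * Real.pi * a * θ * triWave y : ℝ) : ℂ) * Complex.I = ((-(2 * Real.pi * a * θ * triWave y) : ℝ) : ℂ) * Complex.I by push_cast; ring,
        show -((2 * Real.pi * ξ' * y : ℝ) : ℂ) * Complex.I = ((-(2 * Real.pi * ξ' * y) : ℝ) : ℂ) * Complex.I by push_cast; ring,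
        Complex.norm_exp_ofReal_mul_I, Complex.norm_exp_ofReal_mul_I]; norm_num)
  exact h.trans (le_of_eq (by norm_num))

end Summit.AnomalousDissipation.AnomalousDissipation.Theorems.SawtoothPulseCascade.K2PhaseBudget

end
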